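/-
Copyright (c) 2026 the pub-hodgecm-mathlib formalisation cell (harness21).  Prover seat hodgecm-mathlib-LH10-p01 (g10): road «M6 ∕ F3 TOT-Λ BY OVER-ORDERS»
(LEAD T14-66; dealer LH4-plan (g8) WORD #77; LH7-p04 (g11) ROUTING FLAG (i) of SIG-F3-2b (B3) delta 5a9da9c3b6f61ee7), carve (c3) «EXHAUSTION» for F3-5: every order between the
type-(2) order `R = G(N, n, c)` and the maximal order `𝒪 × O₁` is one of ★ F3-1a's glued orders `G(N″, b, c′)` — the input of ★ F3-2b FILE 2's `hcov`; 2026-09-02.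
-/
import Mathlib.RingTheory.DiscreteValuationRing.Basic
import Literature.NumberTheory.Automorphic.GluedOverOrders   -- ★ F3-1a (LH7-p04 (g11)): the glued orders `G(N″,b,c′)` (as sets), `gen_mem_glued`, `glued_subset_glued_iff`, `glued_eq_glued_iff`, `snd_gen_mul_self`; brings ★ `coord_unique`
import HarnessLib

/-!
# Exhaustion: every over-order of the type-(2) order inside `𝒪 × O₁` is a glued order `G(N″, b, c′)`

Topic `NumberTheory/Automorphic`; namespace `Literature.NumberTheory.Automorphic`.  THEOREMS ONLY (no definition, no instance, no notation, no named fact, no `sorry`).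
Cell `pub/hodgecm-mathlib` (D-0151), crux H413 = `stmt-HodgeConjecture-24833`; road M6 → F3 «TOT-Λ by over-orders», the covering hypothesis `hcov` of ★ F3-2b's partition
`setOf_selfDual_stable_eq_biUnion` ∕ `ncard_setOf_selfDual_stable_eq_finsum`: the family `𝓞` of glued orders must contain the multiplier ring of EVERY self-dual `τ`-stable
lattice; this file supplies the commutative algebra — Goursat's lemma for subrings of `𝒪 × O₁` over the diagonal.

FRAME = ★ F3-1a `GluedOverOrders`: `𝒪 = 𝒪[E]` (`ValuativeRel E`), `j : 𝒪 →+* O₁`, `θ` with `θ² = j a·θ + j k`, unique coordinates `hcoord` on `(1, θ)`, a parameter `ϖO : 𝒪`;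
here moreover `𝒪` is a discrete valuation ring and `ϖO` is IRREDUCIBLE (every non-zero ideal is `(ϖO^m)`).  The glued order is, as in ★ F3-1a, the SET
`G(N″, b, c′) = {(y, j b₀ + j c₀·Π_{N″}) | y ≡ b₀ + c₀ c′ (mod ϖ^b)}`, `Π_{N″} = j(ϖ^{N″})·θ`, spelled out at each use.

THE MATHEMATICS (Goursat).  Let `S ≤ 𝒪 × O₁` be a subring containing the diagonal `δ(𝒪) = {(y, j y)}`.  (1) The first slice `I₁ = {y | (y, 0) ∈ S}` is an ideal of `𝒪`;
if `(ϖ^n, 0) ∈ S` it is non-zero, so `I₁ = (ϖ^b)` with `b ≤ n`.  (2) The `θ`-coordinates of `pr₂ S` form an ideal `I₂`; if some `(y, Π_N) ∈ S` it is non-zero, `I₂ = (ϖ^{N″})`,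
`N″ ≤ N`, and (subtracting diagonal elements) `pr₂ S = j𝒪 ⊕ j𝒪·Π_{N″} = O_{N″}`.  (3) Pick `c′` with `(c′, Π_{N″}) ∈ S`.  Then `S = G(N″, b, c′)`: `⊇` because
`(y, j b₀ + j c₀ Π) = δ(b₀) + δ(c₀)(c′, Π) + (y − b₀ − c₀c′, 0)`; `⊆` because for `(y, x) ∈ S`, `x = j b₀ + j c₀ Π` by (2) and then `(y − b₀ − c₀ c′, 0) ∈ S`.  (4) The character
congruence `c′² ≡ ϖ^{N″}a c′ + ϖ^{2N″}k (mod ϖ^b)` holds because `(c′, Π)² = (c′², j(ϖ^{2N″}k) + j(ϖ^{N″}a)Π) ∈ S`.  COROLLARY: every subring `S ⊇ δ(𝒪) ∪ G(N, n, c)` is a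
`G(N″, b, c′)` with `N″ ≤ N`, `b ≤ n`, `c′` lawful and compatible (`ϖ^{N−N″}c′ ≡ c (mod ϖ^b)`, ★ `glued_subset_glued_iff`); and there are only FINITELY many such `S` when `𝒪∕(ϖ^n)`
is finite.

* §1 `exists_setOf_fst_mem_eq_span_pow` (first slice), `exists_setOf_coord_eq_span_pow` (θ-coordinates of `pr₂ S`).
* §2 **`exists_coe_eq_glued_of_mem`** (the exhaustion), **`exists_coe_eq_glued_of_glued_subset`** (over-orders of `R = G(N, n, c)`).
* §3 **`finite_setOf_subring_glued_subset`** (finiteness of the family of over-orders of `R`).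

## References
* [Neukirch1999] J. Neukirch, *Algebraic Number Theory*, Grundlehren 322 (1999): Ch. I §12 (orders, conductors; orders in products as fibre products).
* [Bass1963] H. Bass, *On the ubiquity of Gorenstein rings*, Math. Z. 82 (1963): §7 (glued ∕ fibre-product orders).
* [SerreLocalFields1979] J.-P. Serre, *Local Fields*, GTM 67 (1979): Ch. I §6, Ch. IV §1 (ideals `(π^m)` of a discrete valuation ring).
* [Jacobowitz1962] R. Jacobowitz, *Hermitian forms over local fields*, Amer. J. Math. 84 (1962): §7 (multiplier orders of hermitian lattices).
-/

set_option autoImplicit false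

open scoped ValuativeRel

namespace Literature.NumberTheory.Automorphic

variable {E : Type*} [Field E] [ValuativeRel E] {O₁ : Type*} [CommRing O₁] (j : 𝒪[E] →+* O₁) (θ : O₁) {a k : 𝒪[E]} (ϖO : 𝒪[E])
  (hθ : θ * θ = j a * θ + j k) (hcoord : ∀ z : O₁, ∃! bc : 𝒪[E] × 𝒪[E], z = j bc.1 + j bc.2 * θ)

/-! ## §1 The two slices of a subring over the diagonal -/

/-- Subtracting a diagonal element: `(y, x) ∈ S ⇒ (y − b₀, x − j b₀) ∈ S`. [cite: Neukirch1999, Ch. I §12] -/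
theorem sub_diag_mem (S : Subring (𝒪[E] × O₁)) (hδ : ∀ y : 𝒪[E], ((y, j y) : 𝒪[E] × O₁) ∈ S) {y : 𝒪[E]} {x : O₁}
    (h : ((y, x) : 𝒪[E] × O₁) ∈ S) (b₀ : 𝒪[E]) : ((y - b₀, x - j b₀) : 𝒪[E] × O₁) ∈ S := by
  have h' := S.sub_mem h (hδ b₀)
  rwa [Prod.mk_sub_mk] at h'

/-- **THE FIRST SLICE IS `(ϖ^b)`, `b ≤ n`**: for a subring `S ⊇ δ(𝒪)` of `𝒪 × O₁` with `(ϖ^n, 0) ∈ S` (`𝒪` a DVR, `ϖ` irreducible), `{y | (y, 0) ∈ S} = (ϖ^b)` for some `b ≤ n`.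
[cite: Neukirch1999, Ch. I §12] [cite: SerreLocalFields1979, Ch. IV §1] -/
theorem exists_setOf_fst_mem_eq_span_pow [IsDiscreteValuationRing 𝒪[E]] (hϖ : Irreducible ϖO) (S : Subring (𝒪[E] × O₁))
    (hδ : ∀ y : 𝒪[E], ((y, j y) : 𝒪[E] × O₁) ∈ S) {n : ℕ} (hn : ((ϖO ^ n, 0) : 𝒪[E] × O₁) ∈ S) :
    ∃ b : ℕ, b ≤ n ∧ {y : 𝒪[E] | ((y, (0 : O₁)) : 𝒪[E] × O₁) ∈ S} = (Ideal.span {ϖO ^ b} : Set 𝒪[E]) := by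
  let I₁ : Ideal 𝒪[E] :=
    { carrier := {y : 𝒪[E] | ((y, (0 : O₁)) : 𝒪[E] × O₁) ∈ S}
      add_mem' := fun {y y'} hy hy' => by
        have h := S.add_mem hy hy'
        rwa [Prod.mk_add_mk, add_zero] at h
      zero_mem' := S.zero_mem
      smul_mem' := fun c {y} hy => by
        have h := S.mul_mem (hδ c) hy
        rwa [Prod.mk_mul_mk, mul_zero] at h }
  have hI₁ : I₁ ≠ ⊥ := fun h => by
    have hmem : ϖO ^ n ∈ I₁ := hn
    rw [h, Ideal.mem_bot] at hmem
    exact pow_ne_zero n hϖ.ne_zero hmem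
  obtain ⟨b, hb⟩ := IsDiscreteValuationRing.ideal_eq_span_pow_irreducible hI₁ hϖ
  refine ⟨b, ?_, ?_⟩
  · have hmem : ϖO ^ n ∈ Ideal.span {ϖO ^ b} := hb ▸ (hn : ϖO ^ n ∈ I₁)
    exact (pow_dvd_pow_iff hϖ.ne_zero hϖ.not_isUnit).1 (Ideal.mem_span_singleton.1 hmem)
  · exact congrArg (fun I : Ideal 𝒪[E] => (I : Set 𝒪[E])) hb

/-- **THE `θ`-COORDINATES OF `pr₂ S` FORM `(ϖ^{N″})`, `N″ ≤ N`**: for a subring `S ⊇ δ(𝒪)` with some `(y, Π_N) ∈ S`, the set of `θ`-coordinates `c₀` of second components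
`j b₀ + j c₀ θ` of elements of `S` is the ideal `(ϖ^{N″})` for some `N″ ≤ N`. [cite: Neukirch1999, Ch. I §12] [cite: SerreLocalFields1979, Ch. IV §1] -/
theorem exists_setOf_coord_eq_span_pow [IsDiscreteValuationRing 𝒪[E]] (hϖ : Irreducible ϖO) (S : Subring (𝒪[E] × O₁))
    (hδ : ∀ y : 𝒪[E], ((y, j y) : 𝒪[E] × O₁) ∈ S) {N : ℕ} (hN : ∃ y : 𝒪[E], ((y, j (ϖO ^ N) * θ) : 𝒪[E] × O₁) ∈ S) :
    ∃ N'' : ℕ, N'' ≤ N ∧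
      {c₀ : 𝒪[E] | ∃ y b₀ : 𝒪[E], ((y, j b₀ + j c₀ * θ) : 𝒪[E] × O₁) ∈ S} = (Ideal.span {ϖO ^ N''} : Set 𝒪[E]) := by
  let I₂ : Ideal 𝒪[E] :=
    { carrier := {c₀ : 𝒪[E] | ∃ y b₀ : 𝒪[E], ((y, j b₀ + j c₀ * θ) : 𝒪[E] × O₁) ∈ S}
      add_mem' := fun {c c'} hc hc' => by
        obtain ⟨y, b₀, h⟩ := hc
        obtain ⟨y', b₀', h'⟩ := hc'
        refine ⟨y + y', b₀ + b₀', ?_⟩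
        have hs := S.add_mem h h'
        rw [Prod.mk_add_mk] at hs
        convert hs using 2
        simp only [map_add]; ring
      zero_mem' := ⟨0, 0, by simp only [map_zero, zero_mul, add_zero]; exact S.zero_mem⟩
      smul_mem' := fun c {c₀} hc₀ => by
        obtain ⟨y, b₀, h⟩ := hc₀
        refine ⟨c * y, c * b₀, ?_⟩
        have hs := S.mul_mem (hδ c) h
        rw [Prod.mk_mul_mk] at hs
        convert hs using 2
        simp only [smul_eq_mul, map_mul]; ring }
  have hNmem : ϖO ^ N ∈ I₂ := by
    obtain ⟨y, hy⟩ := hN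
    exact ⟨y, 0, by simpa using hy⟩
  have hI₂ : I₂ ≠ ⊥ := fun h => by
    rw [h, Ideal.mem_bot] at hNmem
    exact pow_ne_zero N hϖ.ne_zero hNmem
  obtain ⟨N'', hN''⟩ := IsDiscreteValuationRing.ideal_eq_span_pow_irreducible hI₂ hϖ
  refine ⟨N'', ?_, congrArg (fun I : Ideal 𝒪[E] => (I : Set 𝒪[E])) hN''⟩
  rw [hN''] at hNmem
  exact (pow_dvd_pow_iff hϖ.ne_zero hϖ.not_isUnit).1 (Ideal.mem_span_singleton.1 hNmem)

/-! ## §2 The exhaustion -/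

include hθ hcoord in
/-- **EXHAUSTION — EVERY SUBRING OF `𝒪 × O₁` OVER THE DIAGONAL WITH NON-DEGENERATE SLICES IS A GLUED ORDER.**  `𝒪` a DVR, `ϖ` irreducible; `S ⊇ δ(𝒪)` a subring with
`(ϖ^n, 0) ∈ S` and some `(y, Π_N) ∈ S`.  Then `S = G(N″, b, c′) = {(y, j b₀ + j c₀ Π_{N″}) | y ≡ b₀ + c₀c′ (mod ϖ^b)}` for some `N″ ≤ N`, `b ≤ n` and a LAWFUL `c′`
(`c′² ≡ ϖ^{N″}a c′ + ϖ^{2N″}k (mod ϖ^b)`).  Goursat: `b` from the first slice (§1), `N″` from the `θ`-coordinates (§1), `c′` the first coordinate of a lift of `Π_{N″}`; the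
congruence from `(c′, Π_{N″})² ∈ S` and ★ `snd_gen_mul_self`. [cite: Neukirch1999, Ch. I §12] [cite: Bass1963, §7] -/
theorem exists_coe_eq_glued_of_mem [IsDiscreteValuationRing 𝒪[E]] (hϖ : Irreducible ϖO) (S : Subring (𝒪[E] × O₁))
    (hδ : ∀ y : 𝒪[E], ((y, j y) : 𝒪[E] × O₁) ∈ S) {n : ℕ} (hn : ((ϖO ^ n, 0) : 𝒪[E] × O₁) ∈ S)
    {N : ℕ} (hN : ∃ y : 𝒪[E], ((y, j (ϖO ^ N) * θ) : 𝒪[E] × O₁) ∈ S) :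
    ∃ (N'' b : ℕ) (c' : 𝒪[E]), N'' ≤ N ∧ b ≤ n ∧ c' * c' - (ϖO ^ N'' * a * c' + ϖO ^ (2 * N'') * k) ∈ Ideal.span {ϖO ^ b} ∧
      (S : Set (𝒪[E] × O₁)) =
        {z : 𝒪[E] × O₁ | ∃ b₀ c₀ : 𝒪[E], z.2 = j b₀ + j c₀ * (j (ϖO ^ N'') * θ) ∧ z.1 - (b₀ + c₀ * c') ∈ Ideal.span {ϖO ^ b}} := by
  obtain ⟨b, hbn, hI₁⟩ := exists_setOf_fst_mem_eq_span_pow j ϖO hϖ S hδ hn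
  obtain ⟨N'', hN''N, hI₂⟩ := exists_setOf_coord_eq_span_pow j θ ϖO hϖ S hδ hN
  -- membership in the two slices
  have hfst : ∀ y : 𝒪[E], ((y, (0 : O₁)) : 𝒪[E] × O₁) ∈ S ↔ y ∈ Ideal.span {ϖO ^ b} := fun y => Set.ext_iff.1 hI₁ y
  have hcrd : ∀ c₀ : 𝒪[E], (∃ y b₀ : 𝒪[E], ((y, j b₀ + j c₀ * θ) : 𝒪[E] × O₁) ∈ S) ↔ c₀ ∈ Ideal.span {ϖO ^ N''} :=
    fun c₀ => Set.ext_iff.1 hI₂ c₀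
  -- a lift `(c′, Π_{N″}) ∈ S`
  set P : O₁ := j (ϖO ^ N'') * θ with hP
  obtain ⟨y₁, b₁, hy₁⟩ := (hcrd (ϖO ^ N'')).2 (Ideal.mem_span_singleton_self _)
  have hc'P : ((y₁ - b₁, P) : 𝒪[E] × O₁) ∈ S := by
    have h := sub_diag_mem j S hδ hy₁ b₁
    rwa [add_sub_cancel_left] at h
  set c' : 𝒪[E] := y₁ - b₁ with hc'
  -- the generic element `δ(b₀) + δ(c₀)(c′, Π) = (b₀ + c₀ c′, j b₀ + j c₀ Π)`
  have hgen : ∀ b₀ c₀ : 𝒪[E], ((b₀ + c₀ * c', j b₀ + j c₀ * P) : 𝒪[E] × O₁) ∈ S := fun b₀ c₀ => by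
    have h := S.add_mem (hδ b₀) (S.mul_mem (hδ c₀) hc'P)
    rwa [Prod.mk_mul_mk, Prod.mk_add_mk] at h
  have hcoe : (S : Set (𝒪[E] × O₁)) =
      {z : 𝒪[E] × O₁ | ∃ b₀ c₀ : 𝒪[E], z.2 = j b₀ + j c₀ * P ∧ z.1 - (b₀ + c₀ * c') ∈ Ideal.span {ϖO ^ b}} := by
    ext ⟨y, x⟩
    simp only [SetLike.mem_coe, Set.mem_setOf_eq]
    constructor
    · intro hyx
      -- coordinates of `x`, the `θ`-coordinate lies in `(ϖ^{N″})`
      obtain ⟨⟨b₀, c₁⟩, hx, -⟩ := hcoord x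
      simp only at hx
      obtain ⟨c₀, hc₀⟩ := Ideal.mem_span_singleton'.1 ((hcrd c₁).1 ⟨y, b₀, hx ▸ hyx⟩)
      refine ⟨b₀, c₀, ?_, ?_⟩
      · rw [hx, ← hc₀, hP]; simp only [map_mul, map_pow]; ring
      · rw [← hfst]
        have h := S.sub_mem hyx (hgen b₀ c₀)
        rw [Prod.mk_sub_mk] at h
        convert h using 2
        rw [hx, ← hc₀, hP]; simp only [map_mul, map_pow]; ring
    · rintro ⟨b₀, c₀, hx, hy⟩
      have h := S.add_mem (hgen b₀ c₀) ((hfst _).2 hy)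
      rw [Prod.mk_add_mk, add_zero, add_sub_cancel] at h
      rwa [hx]
  refine ⟨N'', b, c', hN''N, hbn, ?_, hcoe⟩
  -- the character congruence from `(c′, Π)² ∈ S`
  have hsq : ((c' * c', P * P) : 𝒪[E] × O₁) ∈ S := by
    have h := S.mul_mem hc'P hc'P
    rwa [Prod.mk_mul_mk] at h
  have hP2 : P * P = j (ϖO ^ (2 * N'') * k) + j (ϖO ^ N'' * a) * P := by
    rw [hP, snd_gen_mul_self j θ ϖO hθ N'', add_comm]
  have hmem : ((c' * c', P * P) : 𝒪[E] × O₁) ∈ (S : Set (𝒪[E] × O₁)) := hsq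
  rw [hcoe] at hmem
  obtain ⟨b₀, c₀, hx, hy⟩ := hmem
  simp only at hx hy
  -- read the coordinates of `P²`
  have hx' : j (ϖO ^ (2 * N'') * k) + j (ϖO ^ N'' * a * ϖO ^ N'') * θ = j b₀ + j (c₀ * ϖO ^ N'') * θ := by
    have h1 : P * P = j (ϖO ^ (2 * N'') * k) + j (ϖO ^ N'' * a * ϖO ^ N'') * θ := by
      rw [hP2, hP]; simp only [map_mul, map_pow]; ring
    have h2 : j b₀ + j c₀ * P = j b₀ + j (c₀ * ϖO ^ N'') * θ := by rw [hP]; simp only [map_mul, map_pow]; ring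
    rw [← h1, ← h2, hx]
  obtain ⟨hb₀, hc₀⟩ := coord_unique j θ hcoord hx'
  have hc₀' : c₀ = ϖO ^ N'' * a := by
    have h : c₀ * ϖO ^ N'' = ϖO ^ N'' * a * ϖO ^ N'' := hc₀.symm
    exact mul_right_cancel₀ (pow_ne_zero _ hϖ.ne_zero) (h.trans (by ring))
  rw [← hb₀, hc₀'] at hy
  have : c' * c' - (ϖO ^ N'' * a * c' + ϖO ^ (2 * N'') * k) = c' * c' - (ϖO ^ (2 * N'') * k + ϖO ^ N'' * a * c') := by ring
  rwa [this]

include hθ hcoord in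
/-- **THE OVER-ORDERS OF THE TYPE-(2) ORDER ARE GLUED ORDERS.**  If a subring `S ⊇ δ(𝒪)` of `𝒪 × O₁` contains `R = G(N, n, c)` then `S = G(N″, b, c′)` with `N″ ≤ N`, `b ≤ n`,
`c′` lawful and COMPATIBLE (`ϖ^{N−N″}c′ ≡ c (mod ϖ^b)`; ★ `glued_subset_glued_iff`).  This discharges the covering hypothesis `hcov` of ★ F3-2b's partition with `𝓞` = the
lawful compatible glued orders. [cite: Neukirch1999, Ch. I §12] [cite: Bass1963, §7] [cite: Jacobowitz1962, §7] -/
theorem exists_coe_eq_glued_of_glued_subset [IsDiscreteValuationRing 𝒪[E]] (hϖ : Irreducible ϖO) (S : Subring (𝒪[E] × O₁))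
    (hδ : ∀ y : 𝒪[E], ((y, j y) : 𝒪[E] × O₁) ∈ S) {N n : ℕ} {c : 𝒪[E]}
    (hRS : {z : 𝒪[E] × O₁ | ∃ b₀ c₀ : 𝒪[E], z.2 = j b₀ + j c₀ * (j (ϖO ^ N) * θ) ∧ z.1 - (b₀ + c₀ * c) ∈ Ideal.span {ϖO ^ n}} ⊆
      (S : Set (𝒪[E] × O₁))) :
    ∃ (N'' b : ℕ) (c' : 𝒪[E]), N'' ≤ N ∧ b ≤ n ∧ c' * c' - (ϖO ^ N'' * a * c' + ϖO ^ (2 * N'') * k) ∈ Ideal.span {ϖO ^ b} ∧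
      ϖO ^ (N - N'') * c' - c ∈ Ideal.span {ϖO ^ b} ∧
      (S : Set (𝒪[E] × O₁)) =
        {z : 𝒪[E] × O₁ | ∃ b₀ c₀ : 𝒪[E], z.2 = j b₀ + j c₀ * (j (ϖO ^ N'') * θ) ∧ z.1 - (b₀ + c₀ * c') ∈ Ideal.span {ϖO ^ b}} := by
  have hn : ((ϖO ^ n, 0) : 𝒪[E] × O₁) ∈ S := hRS ⟨0, 0, by simp, by simp⟩
  have hN : ∃ y : 𝒪[E], ((y, j (ϖO ^ N) * θ) : 𝒪[E] × O₁) ∈ S := ⟨c, hRS (gen_mem_glued j θ ϖO N n c)⟩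
  obtain ⟨N'', b, c', -, -, hlaw, hcoe⟩ := exists_coe_eq_glued_of_mem j θ ϖO hθ hcoord hϖ S hδ hn hN
  rw [hcoe] at hRS
  obtain ⟨hN'', hb, hcomp⟩ := (glued_subset_glued_iff j θ ϖO hcoord c c' hϖ.ne_zero hϖ.not_isUnit).1 hRS
  exact ⟨N'', b, c', hN'', hb, hlaw, hcomp, hcoe⟩

/-! ## §3 Finiteness of the family of over-orders -/

include hθ hcoord in
/-- **FINITELY MANY OVER-ORDERS**: if `𝒪∕(ϖ^n)` is finite, the subrings `S ⊇ δ(𝒪) ∪ G(N, n, c)` of `𝒪 × O₁` form a finite set — each is `G(N″, b, c′)` with `N″ ≤ N`,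
`b ≤ n` and `c′` only mattering modulo `ϖ^b ⊇ (ϖ^n)` (★ `glued_eq_glued_iff`).  (The finiteness input `h𝓞fin` of ★ F3-2b `ncard_setOf_selfDual_stable_eq_finsum`.)
[cite: Neukirch1999, Ch. I §12] [cite: SerreLocalFields1979, Ch. IV §1] -/
theorem finite_setOf_subring_glued_subset [IsDiscreteValuationRing 𝒪[E]] (hϖ : Irreducible ϖO) {N n : ℕ} (c : 𝒪[E])
    [Finite (𝒪[E] ⧸ Ideal.span {ϖO ^ n})] :
    {S : Subring (𝒪[E] × O₁) | (∀ y : 𝒪[E], ((y, j y) : 𝒪[E] × O₁) ∈ S) ∧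
      {z : 𝒪[E] × O₁ | ∃ b₀ c₀ : 𝒪[E], z.2 = j b₀ + j c₀ * (j (ϖO ^ N) * θ) ∧ z.1 - (b₀ + c₀ * c) ∈ Ideal.span {ϖO ^ n}} ⊆
        (S : Set (𝒪[E] × O₁))}.Finite := by
  classical
  -- parameters `(N″, b, class of c′ mod ϖ^n)`
  let f : ℕ × ℕ × (𝒪[E] ⧸ Ideal.span {ϖO ^ n}) → Set (𝒪[E] × O₁) := fun p =>
    {z : 𝒪[E] × O₁ | ∃ b₀ c₀ : 𝒪[E], z.2 = j b₀ + j c₀ * (j (ϖO ^ p.1) * θ) ∧ z.1 - (b₀ + c₀ * Quotient.out p.2.2) ∈ Ideal.span {ϖO ^ p.2.1}}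
  have hT : (Set.Iic N ×ˢ Set.Iic n ×ˢ (Set.univ : Set (𝒪[E] ⧸ Ideal.span {ϖO ^ n}))).Finite :=
    (Set.finite_Iic N).prod ((Set.finite_Iic n).prod Set.finite_univ)
  have hfin : (f '' (Set.Iic N ×ˢ Set.Iic n ×ˢ (Set.univ : Set (𝒪[E] ⧸ Ideal.span {ϖO ^ n})))).Finite := hT.image f
  refine Set.Finite.of_finite_image (f := fun S : Subring (𝒪[E] × O₁) => (S : Set (𝒪[E] × O₁))) (hfin.subset ?_)
    SetLike.coe_injective.injOn
  rintro _ ⟨S, ⟨hδ, hRS⟩, rfl⟩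
  obtain ⟨N'', b, c', hN'', hb, -, -, hcoe⟩ := exists_coe_eq_glued_of_glued_subset j θ ϖO hθ hcoord hϖ S hδ hRS
  refine ⟨(N'', b, Ideal.Quotient.mk (Ideal.span {ϖO ^ n}) c'), ⟨Set.mem_Iic.2 hN'', Set.mem_Iic.2 hb, Set.mem_univ _⟩, ?_⟩
  -- `out (mk c′) ≡ c′ (mod ϖ^n)`, hence mod `ϖ^b`
  have hcc : Quotient.out (Ideal.Quotient.mk (Ideal.span {ϖO ^ n}) c') - c' ∈ Ideal.span {ϖO ^ b} := by
    have hq : Ideal.Quotient.mk (Ideal.span {ϖO ^ n}) (Quotient.out (Ideal.Quotient.mk (Ideal.span {ϖO ^ n}) c')) =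
        Ideal.Quotient.mk (Ideal.span {ϖO ^ n}) c' := Quotient.out_eq' _
    exact Ideal.span_singleton_le_span_singleton.2 (pow_dvd_pow ϖO hb) (Ideal.Quotient.eq.1 hq)
  show f (N'', b, Ideal.Quotient.mk (Ideal.span {ϖO ^ n}) c') = (S : Set (𝒪[E] × O₁))
  rw [hcoe]
  exact (glued_eq_glued_iff j θ ϖO hcoord N'' b _ c' hϖ.ne_zero).2 hcc

end Literature.NumberTheory.Automorphic
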